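import Summits.Ventures.HodgeRepro2.T5SU11SphericalLipschitz
import Summits.Ventures.HodgeRepro2.T5SU11JacobiLaplacePhase

/-!
# The spherical function is Lipschitz in the PHASE variable: `|Φ_λ(s) − Φ_λ(s')| ≤ (λ(2 − λ)/2)|s − s'|`

`T5SU11SphericalLipschitz` bounds the derivative of `u(t) = φ_λ(a_t)` by `(λ(2 − λ)/2) tanh t` for
`0 ≤ λ ≤ 2`, `t ≥ 0`. Since `tanh t = (log cosh t)'`, the functions `(λ(2 − λ)/2) log cosh t ∓ u(t)` are
monotone on `[0, ∞)` (`monotoneOn_log_cosh_sub_sph_hyp`, `monotoneOn_log_cosh_add_sph_hyp`), and in the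
phase variable `s = log cosh t` (`log_cosh_cartanOfPhase`: `cosh t(s) = e^s`) this says

  **`|Φ_λ(s) − Φ_λ(s')| ≤ (λ(2 − λ)/2) |s − s'|`**,  `s, s' ≥ 0`   (`abs_sphPhase_sub_le`),

i.e. `Φ_λ = φ_λ ∘ a_{t(·)}` is Lipschitz on `[0, ∞)` with constant `λ(2 − λ)/2 ≤ 1/2`, although `t(s) ∼ √(2s)`
is not Lipschitz at `0`. At `s' = 0` (`Φ_λ(0) = 1`):

  **`1 − (λ(2 − λ)/2) s ≤ Φ_λ(s) ≤ 1`**   (`one_sub_mul_le_sphPhase`, `sphPhase_le_one`, `abs_sphPhase_sub_one_le`),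

the λ-uniform first-order control of the spherical function near the identity in the variable in which
the Jacobi transform is a Laplace transform (`T5SU11JacobiLaplacePhase`) — the input for quantitative
(rate) versions of the limit laws of the explicit model. Nothing is claimed about (N).

Blind lane: Mathlib + the HodgeRepro2 prefix only; no sorry; axioms ⊆ {propext, Classical.choice,
Quot.sound}.
-/

namespace Summit.Ventures.HodgeRepro2.T5SU11JacobiPhaseLipschitz

open MeasureTheory MeasureTheory.Measure Metric Set Filter Topology
open T5SU11Unimodular T5SU11Fibration T5SU11Cartan T5SU11OneParameter T5SU11CartanProjection T5HaarCircle
  T5BergmanCoefficient T5SU11FibrationHaar T5SU11SphericalFunction T5SU11SphericalSymmetry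
  T5SU11SphericalBounds T5SU11SphericalContinuous T5SU11SphericalDeriv T5SU11SphericalLipschitz
  T5SU11JacobiLaplacePhase
open scoped Real

/-! ### `cosh t(s) = e^s` -/

/-- **`cosh t(s) = e^s`** for `s ≥ 0` (`cosh (arsinh x) = √(1 + x²)`). -/
theorem cosh_cartanOfPhase {s : ℝ} (hs : 0 ≤ s) : Real.cosh (cartanOfPhase s) = Real.exp s := by
  unfold cartanOfPhase
  rw [Real.cosh_arsinh]
  have h1 : 0 ≤ Real.exp (2 * s) - 1 := by
    have := Real.one_le_exp (by linarith : 0 ≤ 2 * s)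
    linarith
  rw [Real.sq_sqrt h1, show (1 : ℝ) + (Real.exp (2 * s) - 1) = Real.exp s ^ 2 by
    rw [← Real.exp_nat_mul]; push_cast; ring_nf, Real.sqrt_sq (Real.exp_pos s).le]

/-- `t(s) ≥ 0`. -/
theorem cartanOfPhase_nonneg' (s : ℝ) : 0 ≤ cartanOfPhase s :=
  Real.arsinh_nonneg_iff.mpr (Real.sqrt_nonneg _)

/-- **`log cosh t(s) = s`** for `s ≥ 0`: the phase is the logarithm of `cosh` of the Cartan coordinate. -/
theorem log_cosh_cartanOfPhase {s : ℝ} (hs : 0 ≤ s) : Real.log (Real.cosh (cartanOfPhase s)) = s := by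
  rw [cosh_cartanOfPhase hs, Real.log_exp]

/-! ### The monotone combinations `(λ(2 − λ)/2) log cosh t ∓ u(t)` -/

/-- `t ↦ log cosh t` has derivative `tanh t`. -/
theorem hasDerivAt_log_cosh (t : ℝ) :
    HasDerivAt (fun t => Real.log (Real.cosh t)) (Real.tanh t) t := by
  have h := (Real.hasDerivAt_cosh t).log (Real.cosh_pos t).ne'
  rwa [← Real.tanh_eq_sinh_div_cosh] at h

/-- `t ↦ log cosh t` is differentiable. -/
theorem differentiable_log_cosh : Differentiable ℝ fun t : ℝ => Real.log (Real.cosh t) :=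
  fun t => (hasDerivAt_log_cosh t).differentiableAt

section measure

variable [MeasurableSpace Circle] [BorelSpace Circle]

/-- **`(λ(2 − λ)/2) log cosh t − u(t)` is monotone on `[0, ∞)`** for `0 ≤ λ ≤ 2`
(its derivative `(λ(2 − λ)/2) tanh t − u'(t)` is `≥ 0` by `T5SU11SphericalLipschitz`). -/
theorem monotoneOn_log_cosh_sub_sph_hyp {lam : ℝ} (h0 : 0 ≤ lam) (h2 : lam ≤ 2) :
    MonotoneOn (fun t : ℝ => lam * (2 - lam) / 2 * Real.log (Real.cosh t) - sph lam (hyp t)) (Ici 0) := by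
  refine monotoneOn_of_deriv_nonneg (convex_Ici 0) ?_ ?_ ?_
  · exact ((differentiable_log_cosh.const_mul _).sub (differentiable_sph_hyp lam)).continuous.continuousOn
  · exact ((differentiable_log_cosh.const_mul _).sub (differentiable_sph_hyp lam)).differentiableOn
  · intro x hx
    rw [interior_Ici] at hx
    have hd : HasDerivAt (fun t : ℝ => lam * (2 - lam) / 2 * Real.log (Real.cosh t) - sph lam (hyp t))
        (lam * (2 - lam) / 2 * Real.tanh x - deriv (fun t => sph lam (hyp t)) x) x :=
      ((hasDerivAt_log_cosh x).const_mul _).sub (differentiable_sph_hyp lam x).hasDerivAt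
    rw [hd.deriv]
    have h := abs_deriv_sph_hyp_le_tanh h0 h2 (le_of_lt hx)
    have := le_abs_self (deriv (fun t => sph lam (hyp t)) x)
    linarith

/-- **`(λ(2 − λ)/2) log cosh t + u(t)` is monotone on `[0, ∞)`** for `0 ≤ λ ≤ 2`. -/
theorem monotoneOn_log_cosh_add_sph_hyp {lam : ℝ} (h0 : 0 ≤ lam) (h2 : lam ≤ 2) :
    MonotoneOn (fun t : ℝ => lam * (2 - lam) / 2 * Real.log (Real.cosh t) + sph lam (hyp t)) (Ici 0) := by
  refine monotoneOn_of_deriv_nonneg (convex_Ici 0) ?_ ?_ ?_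
  · exact ((differentiable_log_cosh.const_mul _).add (differentiable_sph_hyp lam)).continuous.continuousOn
  · exact ((differentiable_log_cosh.const_mul _).add (differentiable_sph_hyp lam)).differentiableOn
  · intro x hx
    rw [interior_Ici] at hx
    have hd : HasDerivAt (fun t : ℝ => lam * (2 - lam) / 2 * Real.log (Real.cosh t) + sph lam (hyp t))
        (lam * (2 - lam) / 2 * Real.tanh x + deriv (fun t => sph lam (hyp t)) x) x :=
      ((hasDerivAt_log_cosh x).const_mul _).add (differentiable_sph_hyp lam x).hasDerivAt
    rw [hd.deriv]
    have h := abs_deriv_sph_hyp_le_tanh h0 h2 (le_of_lt hx)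
    have := neg_abs_le (deriv (fun t => sph lam (hyp t)) x)
    linarith

/-- **`|u(t) − u(t')| ≤ (λ(2 − λ)/2) |log cosh t − log cosh t'|`** for `t, t' ≥ 0`, `0 ≤ λ ≤ 2`. -/
theorem abs_sph_hyp_sub_le_log_cosh {lam : ℝ} (h0 : 0 ≤ lam) (h2 : lam ≤ 2) {t t' : ℝ} (ht : 0 ≤ t)
    (ht' : 0 ≤ t') :
    |sph lam (hyp t) - sph lam (hyp t')|
      ≤ lam * (2 - lam) / 2 * |Real.log (Real.cosh t) - Real.log (Real.cosh t')| := by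
  -- by symmetry assume `t' ≤ t`
  wlog hle : t' ≤ t generalizing t t'
  · have := this ht' ht (le_of_lt (not_le.mp hle))
    rwa [abs_sub_comm, abs_sub_comm (Real.log (Real.cosh t'))] at this
  have hA := monotoneOn_log_cosh_sub_sph_hyp h0 h2 (mem_Ici.mpr ht') (mem_Ici.mpr ht) hle
  have hB := monotoneOn_log_cosh_add_sph_hyp h0 h2 (mem_Ici.mpr ht') (mem_Ici.mpr ht) hle
  simp only at hA hB
  have hlc : Real.log (Real.cosh t') ≤ Real.log (Real.cosh t) := by
    have hc : Real.cosh t' ≤ Real.cosh t := by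
      rw [← Real.cosh_abs t', ← Real.cosh_abs t, abs_of_nonneg ht', abs_of_nonneg ht]
      exact Real.cosh_le_cosh.mpr (by rwa [abs_of_nonneg ht', abs_of_nonneg ht])
    exact Real.log_le_log (Real.cosh_pos t') hc
  rw [abs_of_nonneg (sub_nonneg.mpr hlc), abs_le]
  constructor <;> nlinarith

/-! ### In the phase variable -/

/-- **`Φ_λ` IS LIPSCHITZ IN THE PHASE**: `|Φ_λ(s) − Φ_λ(s')| ≤ (λ(2 − λ)/2) |s − s'|` for `s, s' ≥ 0`,
`0 ≤ λ ≤ 2`. -/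
theorem abs_sphPhase_sub_le {lam : ℝ} (h0 : 0 ≤ lam) (h2 : lam ≤ 2) {s s' : ℝ} (hs : 0 ≤ s)
    (hs' : 0 ≤ s') :
    |sphPhase lam s - sphPhase lam s'| ≤ lam * (2 - lam) / 2 * |s - s'| := by
  unfold sphPhase
  have h := abs_sph_hyp_sub_le_log_cosh h0 h2 (cartanOfPhase_nonneg' s) (cartanOfPhase_nonneg' s')
  rwa [log_cosh_cartanOfPhase hs, log_cosh_cartanOfPhase hs'] at h

/-- **`|Φ_λ(s) − 1| ≤ (λ(2 − λ)/2) s`** for `s ≥ 0`, `0 ≤ λ ≤ 2`. -/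
theorem abs_sphPhase_sub_one_le {lam : ℝ} (h0 : 0 ≤ lam) (h2 : lam ≤ 2) {s : ℝ} (hs : 0 ≤ s) :
    |sphPhase lam s - 1| ≤ lam * (2 - lam) / 2 * s := by
  have h := abs_sphPhase_sub_le h0 h2 hs le_rfl
  rwa [sphPhase_zero, sub_zero, abs_of_nonneg hs] at h

/-- **`Φ_λ(s) ≤ 1`** for `0 ≤ λ ≤ 2` (Jensen, `T5SU11SphericalBounds`). -/
theorem sphPhase_le_one {lam : ℝ} (h0 : 0 ≤ lam) (h2 : lam ≤ 2) (s : ℝ) : sphPhase lam s ≤ 1 :=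
  sph_hyp_le_one h0 h2 _

/-- **`1 − (λ(2 − λ)/2) s ≤ Φ_λ(s)`** for `s ≥ 0`, `0 ≤ λ ≤ 2`. -/
theorem one_sub_mul_le_sphPhase {lam : ℝ} (h0 : 0 ≤ lam) (h2 : lam ≤ 2) {s : ℝ} (hs : 0 ≤ s) :
    1 - lam * (2 - lam) / 2 * s ≤ sphPhase lam s := by
  have h := abs_sphPhase_sub_one_le h0 h2 hs
  rw [abs_le] at h
  linarith [h.1]

/-- **`1 − s/2 ≤ Φ_λ(s) ≤ 1`** for `s ≥ 0`, `0 ≤ λ ≤ 2`: the λ-uniform form (`λ(2 − λ) ≤ 1`). -/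
theorem one_sub_half_le_sphPhase {lam : ℝ} (h0 : 0 ≤ lam) (h2 : lam ≤ 2) {s : ℝ} (hs : 0 ≤ s) :
    1 - s / 2 ≤ sphPhase lam s := by
  refine le_trans ?_ (one_sub_mul_le_sphPhase h0 h2 hs)
  have : lam * (2 - lam) ≤ 1 := by nlinarith [sq_nonneg (lam - 1)]
  nlinarith

/-- **Harish-Chandra's `Ξ` in the phase variable is `1/2`-Lipschitz**: `|Φ_1(s) − Φ_1(s')| ≤ |s − s'|/2`. -/
theorem abs_sphPhase_one_sub_le {s s' : ℝ} (hs : 0 ≤ s) (hs' : 0 ≤ s') :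
    |sphPhase 1 s - sphPhase 1 s'| ≤ |s - s'| / 2 := by
  have h := abs_sphPhase_sub_le (lam := 1) (by norm_num) (by norm_num) hs hs'
  norm_num at h
  linarith

end measure

end Summit.Ventures.HodgeRepro2.T5SU11JacobiPhaseLipschitz
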